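import Summits.KontsevichZagierPeriods.KontsevichZagierPeriods.Theses.CoactionDevissage
import Summits.KontsevichZagierPeriods.KontsevichZagierPeriods.Theorems.FurushoPentagonSectorToKernelOfLeaves
import Summits.KontsevichZagierPeriods.KontsevichZagierPeriods.Theorems.FurushoPentagonSectorToKernelCubeResolutionOfNash
import Literature.NumberTheory.Transcendental.AyoubPeriodSeries
import Literature.NumberTheory.Transcendental.AyoubPeriodSeriesDescent
import Literature.NumberTheory.Transcendental.AyoubPeriodSeriesLocalizing

/-!
# Line `ayoub-compact-presentation` — skeleton for the crux `RationalKernel` (stmt-KontsevichZagierPeriods-3165)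

Crux-strategist (RESTATED re-audit r1), route CoactionDevissage.  The crux `RationalKernel` (Conjecture 1
with `ℚ`-coefficients) is summit-strength by name; this line is its BC2 REDIRECT along Ayoub's compact
presentation, `RationalKernel ⟸ CubeResolution ∧ AyoubEffectiveCubeKernel` (items stmt-17978, stmt-18116),
with each piece opened one level further into its registered birth stubs:

* GEOMETRY (piece X₁ `CubeResolution`, transcendence-free):
  `stub_nashCellReduction` (M/L: a bounded volume is congruent to a `ℤ`-combination of OPEN-cube Nash
  classes of the same dimension — cell decomposition + Nash charts, rules (1a)+(2)) and
  `stub_openCubeNashResolution` (XL, Hironaka strength: an open-cube Nash class is congruent to an element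
  of the TAME cubical span — embedded resolution of the boundary singularities by blow-up charts and power
  substitutions as rule-(2) moves); with Viu-Sos' reduction to bounded volumes
  (`cubeResolution_of_boundedVolumes`, landed) they give X₁.
* TRANSCENDENCE (piece X₂ `AyoubEffectiveCubeKernel` = Ayoub 2015 Conj. 1.1 at `k = ℚ`):
  `stub_oanLocalizedKernel` (conjecture-grade: the kernel of `∫_{[0,1]^∞}` on `𝒪_{ℚ-alg}(𝔻̄^∞)` after
  inverting `2πi` — the half that torsor methods reach in the relative case, AyoubRelKZRevisited Thm. 1.11)
  and `stub_oanPiCancellation` (transcendence-free: `2πi`-cancellation in Ayoub's presented module); they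
  give X₂ by modus ponens.
* SEAM: `kzKernel_of_cubeResolution_of_ayoubKernel` (landed seven-step transfer: resolve → merge →
  admissible → soundness → real Stokes form → semialgebraic primitives → padding + calibration) ⇒ kernel
  form ⇒ `RationalKernel` (`n = 1`).

`RationalKernel_of_stubs : stub₁ → stub₂ → stub₃ → stub₄ → CoactionDevissage.RationalKernel` is proved below
sorry-free, and the registered composition `RationalKernel_of : CoactionDevissage.RationalKernel` applies it to the
four declared stubs by name; the only sorries are the four stubs.  Hardest stubs: `stub_openCubeNashResolution` (theorem-grade,
XL) and `stub_oanLocalizedKernel` (open, GPC strength after inverting `2πi`).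
-- adapted from Cruxes/ReductionRigidity/SplitR1CubeResolutionBirth.lean and SplitR1AyoubEffectiveCubeKernelBirth.lean (planner-cstrat-stmt-KontsevichZagierPeriods-3407-r1-0)
-/

noncomputable section

set_option linter.dupNamespace false

namespace Summit.KontsevichZagierPeriods.KontsevichZagierPeriods.Cruxes.RationalKernel.AyoubCompactPresentation

open Set MeasureTheory
open Literature.NumberTheory.Transcendental
open Literature.NumberTheory.Transcendental.KZ hiding cubicalSpan
open Literature.NumberTheory.Transcendental.AyoubRel
open Summit.KontsevichZagierPeriods.FurushoPentagon.ReducedPeriodRing (unitCube cubicalGens cubicalSpan)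
open Summit.KontsevichZagierPeriods.FurushoPentagon.SectorToKernel
  (cubeResolution_of_boundedVolumes kzKernel_of_cubeResolution_of_ayoubKernel)

/-- The OPEN-CUBE NASH classes of dimension `m`: `[(0,1)ᵐ, J]`, `J` real analytic on the open cube. -/
def openCubeNashGens (m : ℕ) : Set FormalRep :=
  {d | ∃ v : IntegralRep m, v.domain = {x : Fin m → ℝ | ∀ i, 0 < x i ∧ x i < 1} ∧
    AnalyticOnNhd ℝ v.integrand {x : Fin m → ℝ | ∀ i, 0 < x i ∧ x i < 1} ∧ d = of v}

/-- STUB 1 (M/L, geometry) — **bounded volumes reduce to open-cube Nash classes of the same dimension**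
(cell decomposition of the bounded `ℚ`-semialgebraic solid, rule (1a) across the null walls, and the Nash
chart of each open cell onto `(0,1)ᵐ`, rule (2), Jacobian `|det Φ'|`).
[cite: KontsevichZagier2001, §1.2 rules (1),(2)] [cite: BochnakCosteRoy1998, Thm. 2.3.6, Prop. 2.9.10] -/
theorem stub_nashCellReduction : ∀ (m : ℕ) (K : IntegralRep m), Bornology.IsBounded K.domain →
    (∀ x ∈ K.domain, K.integrand x = 1) →
    ∃ c ∈ AddSubgroup.closure (openCubeNashGens m), of K - c ∈ relations := by
  sorry

/-- STUB 2 (XL, geometry, hardest theorem-grade stub) — **resolution of an open-cube Nash integrand into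
the tame cubical span** (embedded resolution / rectilinearisation of the boundary singularities by
finitely many `ℚ`-semialgebraic blow-up charts and power substitutions, each ONE rule-(2) instance on an
open piece; absolute integrability forces the boundary exponents after `τᴺ` to be `≥ 0`).
[cite: Hironaka1964] [cite: BierstoneMilman1988, §4–5] [cite: HuberMullerStachPeriods2017, Lemma 12.2.2] -/
theorem stub_openCubeNashResolution : ∀ (m : ℕ) (v : IntegralRep m),
    v.domain = {x : Fin m → ℝ | ∀ i, 0 < x i ∧ x i < 1} →
    AnalyticOnNhd ℝ v.integrand {x : Fin m → ℝ | ∀ i, 0 < x i ∧ x i < 1} →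
    ∃ c ∈ AddSubgroup.closure {d : FormalRep | ∃ (n : ℕ) (r : IntegralRep n),
      r.domain = {x : Fin n → ℝ | ∀ i, 0 ≤ x i ∧ x i ≤ 1} ∧
      AnalyticOnNhd ℝ r.integrand {x : Fin n → ℝ | ∀ i, 0 ≤ x i ∧ x i ≤ 1} ∧ d = of r},
      of v - c ∈ relations := by
  sorry

/-- STUB 3 (conjecture-grade, transcendence) — **the kernel after inverting `2πi`, inside
`𝒪_{ℚ-alg}(𝔻̄^∞)`**: if `∫ F = 0` then some disjoint realisation `g` of a power `(2πi)^N` multiplies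
`F` into the `ℚ`-span of the type-(a) elements.
[cite: AyoubRelKZRevisited, Théorème 1.11, Notation 1.9 (iii)] [cite: Ayoub2015, Conj. 1.1] -/
theorem stub_oanLocalizedKernel : ∀ F ∈ Oan (Rat.castHom ℂ), intC F = 0 →
    ∃ (N : ℕ) (g : CSeries), g ∈ Oan (Rat.castHom ℂ) ∧ (∀ i, ¬ (UsesVar g i ∧ UsesVar F i)) ∧
      intC g = (2 * Real.pi * Complex.I) ^ N ∧
      g * F ∈ kSpan (Rat.castHom ℂ) {x : CSeries | ∃ G ∈ Oan (Rat.castHom ℂ), ∃ i : ℕ, x = relAC i G} := by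
  sorry

/-- STUB 4 (transcendence-free, conjecture-grade) — **`2πi`-cancellation in Ayoub's presented module**:
if a disjoint realisation `g` of `(2πi)^N` multiplies `F ∈ 𝒪_{ℚ-alg}` into the `ℚ`-span of the type-(a)
elements, then `F` itself lies in that span.
[cite: AyoubRelKZRevisited, Notation 1.9 (ii)–(iii)] [cite: HuberWustholz2022, App. A] -/
theorem stub_oanPiCancellation : ∀ F ∈ Oan (Rat.castHom ℂ), ∀ (N : ℕ) (g : CSeries),
    g ∈ Oan (Rat.castHom ℂ) → (∀ i, ¬ (UsesVar g i ∧ UsesVar F i)) →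
    intC g = (2 * Real.pi * Complex.I) ^ N →
    g * F ∈ kSpan (Rat.castHom ℂ) {x : CSeries | ∃ G ∈ Oan (Rat.castHom ℂ), ∃ i : ℕ, x = relAC i G} →
    F ∈ kSpan (Rat.castHom ℂ) {x : CSeries | ∃ G ∈ Oan (Rat.castHom ℂ), ∃ i : ℕ, x = relAC i G} := by
  sorry

/-- Closure induction: if every generator of `S` is congruent modulo relations to an element of the
subgroup `T`, so is every element of `closure S`. [folklore] -/
theorem closure_reduces {S : Set FormalRep} {T : AddSubgroup FormalRep}
    (h : ∀ s ∈ S, ∃ t ∈ T, s - t ∈ relations) :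
    ∀ c ∈ AddSubgroup.closure S, ∃ t ∈ T, c - t ∈ relations := by
  intro c hc
  induction hc using AddSubgroup.closure_induction with
  | mem x hx => exact h x hx
  | zero => exact ⟨0, T.zero_mem, by simp⟩
  | add x y _ _ hx hy =>
    obtain ⟨a, ha, hxa⟩ := hx
    obtain ⟨b, hb, hyb⟩ := hy
    refine ⟨a + b, T.add_mem ha hb, ?_⟩
    have : x + y - (a + b) = (x - a) + (y - b) := by abel
    rw [this]
    exact relations.add_mem hxa hyb
  | neg x _ hx =>
    obtain ⟨a, ha, hxa⟩ := hx
    refine ⟨-a, T.neg_mem ha, ?_⟩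
    have : -x - -a = -(x - a) := by abel
    rw [this]
    exact relations.neg_mem hxa

/-- **Piece X₁ from stubs 1–2** (the statement of item stmt-17978, in `cubicalSpan` form): bounded volumes
→ open-cube Nash span → tame cubical span (generator by generator), then every representation by
Viu-Sos' reduction `cubeResolution_of_boundedVolumes` (landed). [cite: ViuSos2021, Thm. 1.1] [folklore] -/
theorem cubeResolution_of_stubs
    (hcell : ∀ (m : ℕ) (K : IntegralRep m), Bornology.IsBounded K.domain →
      (∀ x ∈ K.domain, K.integrand x = 1) →
      ∃ c ∈ AddSubgroup.closure (openCubeNashGens m), of K - c ∈ relations)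
    (hres : ∀ (m : ℕ) (v : IntegralRep m), v.domain = {x : Fin m → ℝ | ∀ i, 0 < x i ∧ x i < 1} →
      AnalyticOnNhd ℝ v.integrand {x : Fin m → ℝ | ∀ i, 0 < x i ∧ x i < 1} →
      ∃ c ∈ AddSubgroup.closure {d : FormalRep | ∃ (n : ℕ) (r : IntegralRep n),
        r.domain = {x : Fin n → ℝ | ∀ i, 0 ≤ x i ∧ x i ≤ 1} ∧
        AnalyticOnNhd ℝ r.integrand {x : Fin n → ℝ | ∀ i, 0 ≤ x i ∧ x i ≤ 1} ∧ d = of r},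
        of v - c ∈ relations) :
    ∀ (N : ℕ) (u : IntegralRep N), ∃ c : FormalRep, c ∈ cubicalSpan ∧ of u - c ∈ relations := by
  have hvol : ∀ (m : ℕ) (K : IntegralRep m), Bornology.IsBounded K.domain →
      (∀ x ∈ K.domain, K.integrand x = 1) → ∃ c : FormalRep, c ∈ cubicalSpan ∧ of K - c ∈ relations := by
    intro m K hb h1
    obtain ⟨c₁, hc₁, hK⟩ := hcell m K hb h1
    have hgen : ∀ s ∈ openCubeNashGens m, ∃ t ∈ cubicalSpan, s - t ∈ relations := by
      rintro s ⟨v, hvd, hva, rfl⟩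
      obtain ⟨t, ht, hvt⟩ := hres m v hvd hva
      exact ⟨t, ht, hvt⟩
    obtain ⟨c₂, hc₂, h₁₂⟩ := closure_reduces hgen c₁ hc₁
    refine ⟨c₂, hc₂, ?_⟩
    have : of K - c₂ = (of K - c₁) + (c₁ - c₂) := by abel
    rw [this]
    exact relations.add_mem hK h₁₂
  intro N u
  obtain ⟨c, hc, huc⟩ := cubeResolution_of_boundedVolumes hvol N u
  exact ⟨c, hc, huc⟩

/-- **Piece X₂ from stubs 3–4** (the statement of item stmt-18116): localised kernel + `2πi`-cancellation.
[cite: Ayoub2015, Conj. 1.1] [folklore] -/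
theorem ayoubEffectiveCubeKernel_of_stubs
    (hloc : ∀ F ∈ Oan (Rat.castHom ℂ), intC F = 0 →
      ∃ (N : ℕ) (g : CSeries), g ∈ Oan (Rat.castHom ℂ) ∧ (∀ i, ¬ (UsesVar g i ∧ UsesVar F i)) ∧
        intC g = (2 * Real.pi * Complex.I) ^ N ∧
        g * F ∈ kSpan (Rat.castHom ℂ) {x : CSeries | ∃ G ∈ Oan (Rat.castHom ℂ), ∃ i : ℕ, x = relAC i G})
    (hcancel : ∀ F ∈ Oan (Rat.castHom ℂ), ∀ (N : ℕ) (g : CSeries),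
      g ∈ Oan (Rat.castHom ℂ) → (∀ i, ¬ (UsesVar g i ∧ UsesVar F i)) →
      intC g = (2 * Real.pi * Complex.I) ^ N →
      g * F ∈ kSpan (Rat.castHom ℂ) {x : CSeries | ∃ G ∈ Oan (Rat.castHom ℂ), ∃ i : ℕ, x = relAC i G} →
      F ∈ kSpan (Rat.castHom ℂ) {x : CSeries | ∃ G ∈ Oan (Rat.castHom ℂ), ∃ i : ℕ, x = relAC i G}) :
    ∀ F ∈ Oan (Rat.castHom ℂ), intC F = 0 →
      F ∈ kSpan (Rat.castHom ℂ) {x : CSeries | ∃ G ∈ Oan (Rat.castHom ℂ), ∃ i : ℕ, x = relAC i G} := by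
  intro F hF h0
  obtain ⟨N, g, hg, hdisj, hint, hspan⟩ := hloc F hF h0
  exact hcancel F hF N g hg hdisj hint hspan

/-- **The crux from the four stub STATEMENTS** (written out), concluding `CoactionDevissage.RationalKernel`
BY NAME: stubs 1–2 give the cube resolution, stubs 3–4 give Ayoub's effective cube conjecture, the landed
seven-step seam `kzKernel_of_cubeResolution_of_ayoubKernel` gives the kernel form of Conjecture 1, and the
kernel form gives `RationalKernel` with the multiple `n = 1`.
[cite: KontsevichZagier2001, §1.2 Conjecture 1] [cite: Ayoub2015, Conj. 1.1] [folklore] -/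
theorem RationalKernel_of_stubs :
    (∀ (m : ℕ) (K : IntegralRep m), Bornology.IsBounded K.domain → (∀ x ∈ K.domain, K.integrand x = 1) →
      ∃ c ∈ AddSubgroup.closure (openCubeNashGens m), of K - c ∈ relations) →
    (∀ (m : ℕ) (v : IntegralRep m), v.domain = {x : Fin m → ℝ | ∀ i, 0 < x i ∧ x i < 1} →
      AnalyticOnNhd ℝ v.integrand {x : Fin m → ℝ | ∀ i, 0 < x i ∧ x i < 1} →
      ∃ c ∈ AddSubgroup.closure {d : FormalRep | ∃ (n : ℕ) (r : IntegralRep n),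
        r.domain = {x : Fin n → ℝ | ∀ i, 0 ≤ x i ∧ x i ≤ 1} ∧
        AnalyticOnNhd ℝ r.integrand {x : Fin n → ℝ | ∀ i, 0 ≤ x i ∧ x i ≤ 1} ∧ d = of r},
        of v - c ∈ relations) →
    (∀ F ∈ Oan (Rat.castHom ℂ), intC F = 0 →
      ∃ (N : ℕ) (g : CSeries), g ∈ Oan (Rat.castHom ℂ) ∧ (∀ i, ¬ (UsesVar g i ∧ UsesVar F i)) ∧
        intC g = (2 * Real.pi * Complex.I) ^ N ∧
        g * F ∈ kSpan (Rat.castHom ℂ) {x : CSeries | ∃ G ∈ Oan (Rat.castHom ℂ), ∃ i : ℕ, x = relAC i G}) →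
    (∀ F ∈ Oan (Rat.castHom ℂ), ∀ (N : ℕ) (g : CSeries),
      g ∈ Oan (Rat.castHom ℂ) → (∀ i, ¬ (UsesVar g i ∧ UsesVar F i)) →
      intC g = (2 * Real.pi * Complex.I) ^ N →
      g * F ∈ kSpan (Rat.castHom ℂ) {x : CSeries | ∃ G ∈ Oan (Rat.castHom ℂ), ∃ i : ℕ, x = relAC i G} →
      F ∈ kSpan (Rat.castHom ℂ) {x : CSeries | ∃ G ∈ Oan (Rat.castHom ℂ), ∃ i : ℕ, x = relAC i G}) →
    Summit.KontsevichZagierPeriods.KontsevichZagierPeriods.Theses.CoactionDevissage.RationalKernel := by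
  intro hcell hres hloc hcancel c hc
  have hK : ∀ c : FormalRep, eval c = 0 → c ∈ relations :=
    kzKernel_of_cubeResolution_of_ayoubKernel (cubeResolution_of_stubs hcell hres)
      (ayoubEffectiveCubeKernel_of_stubs hloc hcancel)
  exact ⟨1, one_ne_zero, by simpa using hK c hc⟩

/-- **REGISTERED COMPOSITION — the crux from the four declared stubs BY NAME** (no hypotheses; the only
sorries are inside `stub_*`): `RationalKernel_of : CoactionDevissage.RationalKernel`.
[cite: KontsevichZagier2001, §1.2 Conjecture 1] [cite: Ayoub2015, Conj. 1.1] [folklore] -/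
theorem RationalKernel_of :
    Summit.KontsevichZagierPeriods.KontsevichZagierPeriods.Theses.CoactionDevissage.RationalKernel :=
  RationalKernel_of_stubs stub_nashCellReduction stub_openCubeNashResolution stub_oanLocalizedKernel
    stub_oanPiCancellation

end Summit.KontsevichZagierPeriods.KontsevichZagierPeriods.Cruxes.RationalKernel.AyoubCompactPresentation
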